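import Summits.ResolutionOfSingularities.ResolutionOfSingularities.Theorems.WeightedInvariantContactFiltrationCanonical
import Summits.ResolutionOfSingularities.ResolutionOfSingularities.Theorems.WeightedInvariantHypersurfaceLocalGameEFTDimTwoContact
import HarnessLib

/-!
# The contact ladder terminates: if EVERY level is reached, `f` is of monomial type (door `HypersurfaceCentreConstruction`, rung P2)

Topic: `Summits/ResolutionOfSingularities/ResolutionOfSingularities/Theorems`. Helper for the door item
`HypersurfaceCentreConstruction` (statement `stmt-ResolutionOfSingularities-19897`, route `WeightedInvariant`), line
`local-engine` of `res-L1-w43-plan-1`, rung **P2**, ORDER (o24-D) (definition module `…ContactCentreFiltration` =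
res-type-092; PROOFS second hand = res-type-070, res-L1-w43-plan-1 DESIGN AMENDMENT v1.1 2026-08-27T08:05:47Z).  This file
is the DEFINITION-FREE CORE of target `one_le_bMax_and_reaches` («`b_max` is attained»), written over res-type-078's
inline contact filtration `⨆ j, (g^j) · 𝔪^{n - b j}` (`…ContactFiltrationCanonical`, p511384) so that it does not wait for the
definition module; the `bMax` wrapper is ten lines once the definitions land.

[OURS · L1 W4.3] Replaces the role of NO printed item; NOT a statement of the manuscript
[claim: Hironaka2017, status: under-review]. AI work, weaker than expert review.

## Statement proved

`ContactFiltration.exists_associated_pow_of_forall_level`: let `S` be an EXCELLENT regular local ring (any dimension),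
`1 ≤ ν`, `f ∉ 𝔪^{ν+1}`, and suppose that for EVERY level `b ≥ 2` some contact parameter `g_b ∈ 𝔪 ∖ 𝔪²` carries `f` to
level `bν` (`f ∈ ⨆ j, (g_b^j) 𝔪^{bν - bj}`).  Then `f` is a unit times `π^ν` for some `π ∈ 𝔪 ∖ 𝔪²` (MONOMIAL TYPE).
Contrapositive = the boundedness half of `one_le_bMax_and_reaches`: at a position NOT of monomial type the reached levels are
bounded, so `b_max = sSup` is attained.  The excellence binder is NECESSARY: over Nagata's non-excellent discrete valuation
ring `V = k^p[[x]][k]` (`[k : k^p] = ∞`), in `R = V[y]_{(x,y)}` the prime element `f = y^p - d^p` (`d ∈ k[[x]] ∖ V`, `d^p ∈ V`)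
reaches every level through `y - (d mod x^b)` without being of monomial type (res-type-070 / res-type-092, HOME/STATUS
2026-08-27T08:02:30Z / 08:06:47Z; prose witness, not kernel).

## Proof (unit renormalisation of the maximiser chain, then K6)

By monotonicity in the level (`level_antitone`) the parameters `g_b, g_{b+1}` both reach level `b`, so res-type-078's key step
of C2 (`mem_span_sup_pow_of_mem_contactFiltration`) gives `g_{b+1} ∈ (g_b) + 𝔪^b`, i.e. `g_{b+1} = c_b g_b + r_b` with
`r_b ∈ 𝔪^b ⊆ 𝔪²` — and `c_b` is a UNIT because `g_{b+1} ∉ 𝔪²` (`exists_unit_sub_mul_mem_pow`).  The accumulated units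
`e_2 = 1`, `e_{b+1} = e_b c_b⁻¹` renormalise the chain to `y_b := e_b g_b` with `y_{b+1} - y_b = e_b c_b⁻¹ r_b ∈ 𝔪^b`, the
same contact filtrations (`contactFiltration_unit_mul`) and `f ∈ (y_b^ν) + 𝔪^b` (`level_le_span_pow_sup_pow`); res-type-078's
K6 `LocalGameEFTContact.exists_associated_pow_of_adicSteepening` (p505670: the `y_b` converge in `Ŝ` to a formal maximal
contact, excellence algebraises it) finishes.

## References

* H. Hironaka, *Characteristic polyhedra of singularities*, J. Math. Kyoto Univ. 7 (1967) 251–293. [Hironaka1967]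
* V. Cossart, O. Piltant, Math. Ann. 361 (2015) 157–167 (termination of the `(1,b)` steepening). [CossartPiltant2015]
* H. Matsumura, *Commutative Ring Theory*, §32 (excellent rings). [Matsumura1987]
-/

noncomputable section

open IsLocalRing Literature.AlgebraicGeometry.Resolution

set_option linter.dupNamespace false -- mandated namespace of this single-conjunct summit

namespace Summit.ResolutionOfSingularities.ResolutionOfSingularities.Theorems

namespace ContactFiltration

universe u

variable {S : Type u} [CommRing S]

/-! ### Elementary: monotonicity in the level, the `(g^ν) + 𝔪^b` bound, the unit step -/

section Basic

variable [IsLocalRing S]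

/-- The reached levels are DOWNWARD CLOSED: for `b ≤ b'`, level `b'ν` of the `b'`-filtration lies in level `bν` of the
`b`-filtration of the same parameter (`(g^j) 𝔪^{b'(ν-j)} ⊆ (g^j) 𝔪^{b(ν-j)}`). [folklore] -/
theorem level_antitone (g : S) {b b' : ℕ} (hbb' : b ≤ b') (ν : ℕ) :
    (⨆ j, Ideal.span {g ^ j} * maximalIdeal S ^ (b' * ν - b' * j)) ≤
      ⨆ j, Ideal.span {g ^ j} * maximalIdeal S ^ (b * ν - b * j) := by
  refine iSup_le fun j => le_trans (Ideal.mul_mono_right (Ideal.pow_le_pow_right ?_)) (piece_le g b (b * ν) j)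
  rcases le_or_gt j ν with hj | hj
  · rw [← Nat.mul_sub b, ← Nat.mul_sub b']
    exact Nat.mul_le_mul_right _ hbb'
  · have : b * ν - b * j = 0 := Nat.sub_eq_zero_of_le (Nat.mul_le_mul_left _ hj.le)
    rw [this]
    exact Nat.zero_le _

/-- Level `bν` lies in `(g^ν) + 𝔪^b`: the pieces `j ≥ ν` are multiples of `g^ν`, the pieces `j < ν` lie in
`𝔪^{b(ν-j)} ⊆ 𝔪^b`. [folklore] -/
theorem level_le_span_pow_sup_pow (g : S) (b ν : ℕ) :
    (⨆ j, Ideal.span {g ^ j} * maximalIdeal S ^ (b * ν - b * j)) ≤ Ideal.span {g ^ ν} ⊔ maximalIdeal S ^ b := by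
  refine iSup_le fun j => ?_
  rcases le_or_gt ν j with hj | hj
  · refine le_trans Ideal.mul_le_right (le_trans ?_ le_sup_left)
    rw [Ideal.span_singleton_le_iff_mem, Ideal.mem_span_singleton]
    exact pow_dvd_pow g hj
  · refine le_trans Ideal.mul_le_left (le_trans (Ideal.pow_le_pow_right ?_) le_sup_right)
    rw [← Nat.mul_sub b]
    calc b = b * 1 := (mul_one b).symm
      _ ≤ b * (ν - j) := Nat.mul_le_mul_left _ (by omega)

/-- The UNIT STEP: if `g₁ ∈ (g₂) + 𝔪^b` with `2 ≤ b`, `g₂ ∈ 𝔪` and `g₁ ∉ 𝔪²`, then `g₁ = c g₂ + r` with `c` a UNIT and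
`r ∈ 𝔪^b` (if `c ∈ 𝔪` then `g₁ ∈ 𝔪² `). [folklore] -/
theorem exists_unit_sub_mul_mem_pow {g₁ g₂ : S} (hg₁' : g₁ ∉ maximalIdeal S ^ 2) (hg₂ : g₂ ∈ maximalIdeal S)
    {b : ℕ} (hb : 2 ≤ b) (h : g₁ ∈ Ideal.span {g₂} ⊔ maximalIdeal S ^ b) :
    ∃ c : Sˣ, g₁ - c * g₂ ∈ maximalIdeal S ^ b := by
  obtain ⟨a, ha, r, hr, har⟩ := Submodule.mem_sup.mp h
  obtain ⟨c, rfl⟩ := Ideal.mem_span_singleton'.mp ha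
  have hc : IsUnit c := by
    by_contra hcu
    have hcm : c ∈ maximalIdeal S := (IsLocalRing.mem_maximalIdeal c).mpr hcu
    apply hg₁'
    rw [← har]
    refine Ideal.add_mem _ ?_ (Ideal.pow_le_pow_right hb hr)
    rw [pow_two]
    exact Ideal.mul_mem_mul hcm hg₂
  refine ⟨hc.unit, ?_⟩
  rw [IsUnit.unit_spec, ← har, add_sub_cancel_left]
  exact hr

end Basic

/-! ### The core of `one_le_bMax_and_reaches`: unbounded levels force monomial type -/

section Excellent

variable [IsRegularLocalRing S]

/-- **If every level of the contact ladder is reached, `f` is of monomial type.**  `S` an EXCELLENT regular local ring,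
`1 ≤ ν`, `f ∉ 𝔪^{ν+1}`; if for every `b ≥ 2` some `g_b ∈ 𝔪 ∖ 𝔪²` has `f ∈ ⨆ j, (g_b^j) 𝔪^{bν - bj}`, then `f` is associated
with `π^ν` for some `π ∈ 𝔪 ∖ 𝔪²`.  Proof: consecutive maximisers satisfy `g_{b+1} = c_b g_b + r_b`, `c_b` a unit, `r_b ∈ 𝔪^b`
(C2's key step + the unit step); the accumulated units renormalise them into an `𝔪`-adic steepening chain with the same
filtrations, and K6 (`LocalGameEFTContact.exists_associated_pow_of_adicSteepening`) concludes.  The core of target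
`one_le_bMax_and_reaches` of ORDER (o24-D). [cite: Hironaka1967, Thm. (well-preparedness)] [cite: Matsumura1987, §32] -/
theorem exists_associated_pow_of_forall_level (hS : IsExcellentRing S) {f : S} {ν : ℕ} (hν : 1 ≤ ν)
    (hford : f ∉ maximalIdeal S ^ (ν + 1))
    (h : ∀ b : ℕ, 2 ≤ b → ∃ g : S, g ∈ maximalIdeal S ∧ g ∉ maximalIdeal S ^ 2 ∧
      f ∈ ⨆ j, Ideal.span {g ^ j} * maximalIdeal S ^ (b * ν - b * j)) :
    ∃ π : S, π ∈ maximalIdeal S ∧ π ∉ maximalIdeal S ^ 2 ∧ Associated f (π ^ ν) := by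
  classical
  -- maximisers `g k` at level `k + 2`
  choose g hg using fun k : ℕ => h (k + 2) (Nat.le_add_left 2 k)
  -- consecutive comparison through C2's key step: `g (k+1) ∈ (g k) + 𝔪^(k+2)`
  have hcmp : ∀ k, g (k + 1) ∈ Ideal.span {g k} ⊔ maximalIdeal S ^ (k + 2) := by
    intro k
    have h₁ : f ∈ ⨆ j, Ideal.span {g (k + 1) ^ j} * maximalIdeal S ^ ((k + 2) * ν - (k + 2) * j) :=
      level_antitone (g (k + 1)) (Nat.le_succ (k + 2)) ν (hg (k + 1)).2.2
    exact mem_span_sup_pow_of_mem_contactFiltration (hg (k + 1)).1 (hg k).1 (hg k).2.1 (Nat.le_add_left 2 k) hν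
      hford h₁ (hg k).2.2
  -- the unit step
  have hunit : ∀ k, ∃ c : Sˣ, g (k + 1) - c * g k ∈ maximalIdeal S ^ (k + 2) := fun k =>
    exists_unit_sub_mul_mem_pow (hg (k + 1)).2.1 (hg k).1 (Nat.le_add_left 2 k) (hcmp k)
  choose c hc using hunit
  -- accumulated units and the renormalised chain
  let e : ℕ → Sˣ := fun k => ∏ i ∈ Finset.range k, (c i)⁻¹
  have hes : ∀ k, e (k + 1) = e k * (c k)⁻¹ := fun k => Finset.prod_range_succ (fun i => (c i)⁻¹) k
  set y : ℕ → S := fun k => ((e k : Sˣ) : S) * g k with hy_def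
  have hy : ∀ k, y k ∈ maximalIdeal S := fun k => Ideal.mul_mem_left _ _ (hg k).1
  have hy2 : ∀ k, y k ∉ maximalIdeal S ^ 2 := fun k h2 =>
    (hg k).2.1 ((Ideal.unit_mul_mem_iff_mem _ (e k).isUnit).mp h2)
  have hstep : ∀ k, y (k + 1) - y k ∈ maximalIdeal S ^ (k + 2) := by
    intro k
    have hyk : y (k + 1) - y k = ((e k : S) * ↑(c k)⁻¹) * (g (k + 1) - c k * g k) := by
      simp only [hy_def, hes, Units.val_mul]
      rw [mul_sub, mul_assoc, mul_assoc, ← mul_assoc (↑(c k)⁻¹ : S) (c k : S) (g k), Units.inv_mul, one_mul]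
    rw [hyk]
    exact Ideal.mul_mem_left _ _ (hc k)
  have hb : StrictMono (fun k : ℕ => k + 2) := fun a b hab => Nat.add_lt_add_right hab 2
  have hf : ∀ k, f ∈ Ideal.span {y k ^ ν} ⊔ maximalIdeal S ^ (k + 2) := by
    intro k
    have hmem : f ∈ ⨆ j, Ideal.span {y k ^ j} * maximalIdeal S ^ ((k + 2) * ν - (k + 2) * j) := by
      rw [hy_def, contactFiltration_unit_mul (e k).isUnit]
      exact (hg k).2.2
    exact level_le_span_pow_sup_pow (y k) (k + 2) ν hmem
  exact LocalGameEFTContact.exists_associated_pow_of_adicSteepening hS y hy hy2 hb hstep hν hford hf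

/-- The same with conclusion in the MONOMIAL-TYPE shape `f = v * π ^ ν`, `v` a unit (the `IsMonomialType` binder of the
(o24-D) definitions module). [cite: Hironaka1967, Thm. (well-preparedness)] [cite: Matsumura1987, §32] -/
theorem exists_eq_unit_mul_pow_of_forall_level (hS : IsExcellentRing S) {f : S} {ν : ℕ} (hν : 1 ≤ ν)
    (hford : f ∉ maximalIdeal S ^ (ν + 1))
    (h : ∀ b : ℕ, 2 ≤ b → ∃ g : S, g ∈ maximalIdeal S ∧ g ∉ maximalIdeal S ^ 2 ∧
      f ∈ ⨆ j, Ideal.span {g ^ j} * maximalIdeal S ^ (b * ν - b * j)) :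
    ∃ (v π : S), IsUnit v ∧ π ∈ maximalIdeal S ∧ π ∉ maximalIdeal S ^ 2 ∧ f = v * π ^ ν := by
  obtain ⟨π, hπ, hπ2, u, hu⟩ := exists_associated_pow_of_forall_level hS hν hford h
  refine ⟨↑u⁻¹, π, (u⁻¹).isUnit, hπ, hπ2, ?_⟩
  rw [← hu, ← mul_assoc, mul_comm (↑u⁻¹ : S) f, mul_assoc, Units.inv_mul, mul_one]

/-- The binder of the door's positions: `S` essentially of finite type over a field is excellent
(tree `IsExcellentRing.of_essFiniteType`), so the two statements above apply. [cite: Matsumura1987, §32] -/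
theorem exists_eq_unit_mul_pow_of_forall_level_of_essFiniteType (k₀ : Type u) [Field k₀] [Algebra k₀ S]
    [Algebra.EssFiniteType k₀ S] {f : S} {ν : ℕ} (hν : 1 ≤ ν) (hford : f ∉ maximalIdeal S ^ (ν + 1))
    (h : ∀ b : ℕ, 2 ≤ b → ∃ g : S, g ∈ maximalIdeal S ∧ g ∉ maximalIdeal S ^ 2 ∧
      f ∈ ⨆ j, Ideal.span {g ^ j} * maximalIdeal S ^ (b * ν - b * j)) :
    ∃ (v π : S), IsUnit v ∧ π ∈ maximalIdeal S ∧ π ∉ maximalIdeal S ^ 2 ∧ f = v * π ^ ν :=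
  have hk : IsExcellentRing k₀ := Stacks07QW_field_holds k₀ k₀ inferInstance
  exists_eq_unit_mul_pow_of_forall_level (hk.of_essFiniteType ‹_›) hν hford h

end Excellent

end ContactFiltration

end Summit.ResolutionOfSingularities.ResolutionOfSingularities.Theorems

end
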